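import Literature.Geometry.Lorentzian.SpacetimeLocalConvergenceDiagIndex
import Literature.Geometry.Lorentzian.SpacetimeLocalConvergenceTrans
import HarnessLib

/-!
# Limits of limits for FAMILIES: the general diagonal datum; limit sets of spacetimes are CLOSED
(topic `Geometry/Lorentzian`; `Spacetime.LocalSubconvergence.diag`,
`Spacetime.SubconvergesLocallyTo.diag` and `Spacetime.SubconvergesLocallyTo.hull_closed` — the
stage-dependent generalisation of `LocalSubconvergence.trans` (`SpacetimeLocalConvergenceTrans.lean`);
Hale 1980, Ch. I §8, Thm. 8.1 (limit sets are closed); Petersen 2006, Ch. 10, §3.2)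

**Theorem (`LocalSubconvergence.diag`).** Let `E : (𝓤ᵢ, uᵢ) ⇀ (𝓥, v)` be a pointed `Cᵏ_loc`
subconvergence datum of a SEQUENCE of pointed spacetimes (comparison maps `Fⱼ : 𝓥 → 𝓤_{sub j}`) and,
for every `i`, let `D i : (𝓢ᵢₙ, pᵢₙ)ₙ ⇀ (𝓤ᵢ, uᵢ)` be a subconvergence datum (comparison maps
`φᵢₙ`). Then along the explicit strictly increasing stages `i(m) = sub (level (m+1))` and indices
`index m` the diagonal sequence `m ↦ (𝓢_{i(m), sub_{i(m)} (index m)}, φ_{i(m), index m}(F_{level (m+1)} v))`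
converges to `(𝓥, v)` in the pointed `Cᵏ_loc` sense, with comparison maps the composites
`φ_{i(m), index m} ∘ F_{level (m+1)}` and exhaustion `m ↦ U (level m)`.

Consequence (`SubconvergesLocallyTo.hull_closed`): THE HULL OF A SPACETIME IS CLOSED — if every
`(𝓤ᵢ, uᵢ)` is a limit of translates of one spacetime `𝓢` and `(𝓤ᵢ, uᵢ) ⇀ (𝓥, v)`, then `(𝓥, v)` is
a limit of translates of `𝓢`. Together with `SubconvergesLocallyTo.trans` / `.rebase`
(invariance) this is the standard "ω-limit sets are closed and invariant" (Hale 1980, Thm. I.8.1)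
for pointed `Cᵏ_loc` limits of spacetimes.

Construction: word for word that of `LocalSubconvergence.trans`, with the first datum `D (i(m))`
depending on the stage (`SpacetimeLocalConvergenceDiagIndex.lean`): on a reference ball the
deviation of the composite is first bracket + deviation of `F_{level (m+1)}` (→ `0` + `0`), and the
transfer theorem `tendsto_supCkENorm_chartDeviation_of_reference` upgrades this to every compact
chart piece.

## References
* [Hale1980] J. K. Hale, *Ordinary Differential Equations*, 2nd ed., Krieger 1980, Ch. I §8,
  Thm. 8.1 (limit sets are closed and invariant).
* [Petersen2006] P. Petersen, *Riemannian Geometry*, 2nd ed., GTM 171, Springer 2006, Ch. 10, §3.2.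
-/

noncomputable section

open TopologicalSpace Manifold Filter Topology Set Function Metric Bundle
open scoped ContDiff Topology ENNReal

universe u v w

namespace Literature.Geometry.Lorentzian

namespace Spacetime

namespace LocalSubconvergence

variable {𝓤ᵢ : ℕ → Spacetime.{v} 4} {uᵢ : ∀ i, (𝓤ᵢ i).carrier} {𝓥 : Spacetime.{w} 4}
  {v₀ : 𝓥.carrier} {k : ℕ} {𝓢ᵢₙ : ℕ → ℕ → Spacetime.{u} 4} {pᵢₙ : ∀ i n, (𝓢ᵢₙ i n).carrier}

/-! ### Step D: the general diagonal datum -/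

section Datum

variable (D : ∀ i, LocalSubconvergence (𝓢ᵢₙ i) (pᵢₙ i) (𝓤ᵢ i) (uᵢ i) k)
  (E : LocalSubconvergence 𝓤ᵢ uᵢ 𝓥 v₀ k)

/-- The **composite comparison maps** `φ_{i(m), index m} ∘ F_{level (m+1)} : 𝓥 → 𝓢_{i(m), ·}`. [cite: Petersen2006, Ch. 10 §3.2] -/
def diagEmbed (m : ℕ) :
    𝓥.carrier → (𝓢ᵢₙ (E.diagStage m) ((D (E.diagStage m)).sub (diagIndex D E m))).carrier :=
  (D (E.diagStage m)).embed (diagIndex D E m) ∘ E.diagStageMap m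

/-- The **base points of the diagonal sequence**: `Q m = φ_{i(m), index m}(F_{level (m+1)}(v))`. [cite: Petersen2006, Ch. 10 §3.2] -/
def diagBasepoint (m : ℕ) :
    (𝓢ᵢₙ (E.diagStage m) ((D (E.diagStage m)).sub (diagIndex D E m))).carrier :=
  diagEmbed D E m v₀

/-- The base points, explicitly: images of base points of the family members. [folklore] -/
theorem diagBasepoint_eq (m : ℕ) : diagBasepoint D E m =
    (D (E.diagStage m)).embed (diagIndex D E m) (uᵢ (E.diagStage m)) := by
  show (D (E.diagStage m)).embed (diagIndex D E m) (E.diagStageMap m v₀) = _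
  rw [E.diagStageMap_basepoint]

/-- The composite is `C^∞` on `U (level m)`. [folklore] -/
theorem contMDiffOn_diagEmbed (m : ℕ) :
    ContMDiffOn (𝓡 4) (𝓡 4) ∞ (diagEmbed D E m) (E.U (E.diagLevel m)) := by
  refine ((D _).contMDiffOn_embed _).comp ((E.contMDiffOn_diagStageMap m).mono
    (E.U_diagLevel_subset_succ m)) fun x hx ↦ ?_
  exact (diagIndexGood_diagIndex D E m).1 (mem_image_of_mem _ (subset_closure hx))

/-- The composite is a local diffeomorphism on `U (level m)`. [folklore] -/
theorem isLocalDiffeomorphOn_diagEmbed (m : ℕ) :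
    IsLocalDiffeomorphOn (𝓡 4) (𝓡 4) ∞ (diagEmbed D E m) (E.U (E.diagLevel m)) := by
  refine isLocalDiffeomorphOn_comp ((D _).isLocalDiffeomorphOn_embed _)
    (fun x ↦ E.isLocalDiffeomorphOn_embed _ ⟨x.1, E.U_diagLevel_subset_succ m x.2⟩) fun x hx ↦ ?_
  exact (diagIndexGood_diagIndex D E m).1 (mem_image_of_mem _ (subset_closure hx))

/-- The composite is injective on `U (level m)`. [folklore] -/
theorem injOn_diagEmbed (m : ℕ) : InjOn (diagEmbed D E m) (E.U (E.diagLevel m)) :=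
  ((D _).injOn_embed _).comp ((E.injOn_embed _).mono (E.U_diagLevel_subset_succ m)) fun _ hx ↦
    (diagIndexGood_diagIndex D E m).1 (mem_image_of_mem _ (subset_closure hx))

/-- The composite preserves the time orientation on `U (level m)`. [folklore] -/
theorem isFutureDirected_mfderiv_diagEmbed (m : ℕ) {x : 𝓥.carrier}
    (hx : x ∈ E.U (E.diagLevel m)) :
    (𝓢ᵢₙ (E.diagStage m) ((D (E.diagStage m)).sub (diagIndex D E m))).timeOrientation.IsFutureDirected
      (mfderiv (𝓡 4) (𝓡 4) (diagEmbed D E m) x (𝓥.timeOrientation.vectorField x)) :=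
  (diagIndexGood_diagIndex D E m).2.1 x (subset_closure hx)

/-- **Decomposition of the deviation of the composite on a reference ball**:
deviation of `φ ∘ F` from `𝓥` = first bracket + deviation of `F` from `𝓥`. [folklore] -/
theorem chartDeviation_diagEmbed_eq (m : ℕ) (p : 𝓥.carrier) :
    chartDeviation (𝓢ᵢₙ (E.diagStage m) ((D (E.diagStage m)).sub (diagIndex D E m)))
        (diagEmbed D E m) p =
      diagFirstBracket D E (diagIndex D E m) m p + E.coordDeviation (E.diagLevel (m + 1)) p := by
  funext y
  simp only [chartDeviation, diagFirstBracket, coordDeviation, diagEmbed, diagStageMap,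
    Pi.add_apply, Pi.sub_apply]
  abel

/-- **Convergence on the reference balls**: for a reference point `p` of level `m₀` the `Cᵏ` sup
norm over its reference ball of the deviation of the composite tends to `0`. [cite: Petersen2006, Ch. 10 §3.2] -/
theorem tendsto_supCkENorm_diagRefBall {m₀ : ℕ} {p : 𝓥.carrier} (hp : p ∈ E.diagRefPoints m₀) :
    Tendsto (fun m ↦ supCkENorm (E.diagRefBall m₀ p) k
      (chartDeviation (𝓢ᵢₙ (E.diagStage m) ((D (E.diagStage m)).sub (diagIndex D E m)))
        (diagEmbed D E m) p)) atTop (𝓝 0) := by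
  obtain ⟨-, hBt, hBU⟩ := E.diagRefBall_spec hp
  set c := chartAt E4 p with hc
  -- the upper bound, eventually
  have hupper : ∀ᶠ m in atTop, supCkENorm (E.diagRefBall m₀ p) k
      (chartDeviation (𝓢ᵢₙ (E.diagStage m) ((D (E.diagStage m)).sub (diagIndex D E m)))
        (diagEmbed D E m) p) ≤
      ((m + 1 : ℕ) : ℝ≥0∞)⁻¹ + supCkENorm (E.diagRefBall m₀ p) k
        (E.coordDeviation (E.diagLevel (m + 1)) p) := by
    filter_upwards [eventually_ge_atTop (m₀ + 1)] with m hm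
    rw [chartDeviation_diagEmbed_eq]
    -- smoothness of both summands near the ball
    set V₀ : Set E4 := c.target ∩ c.symm ⁻¹' (E.U (E.diagLevel (m₀ + 1)) : Set 𝓥.carrier) with hV₀
    have hV₀o : IsOpen V₀ := c.continuousOn_symm.isOpen_inter_preimage c.open_target (E.U _).isOpen
    have hBV₀ : E.diagRefBall m₀ p ⊆ V₀ := fun y hy ↦ ⟨hBt hy, hBU (mem_image_of_mem _ hy)⟩
    have hEs : ContMDiffOn (𝓡 4) (𝓡 4) ∞ (diagEmbed D E m) (E.U (E.diagLevel (m₀ + 1))) :=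
      (contMDiffOn_diagEmbed D E m).mono (E.U_diagLevel_mono hm)
    have hFs : ContMDiffOn (𝓡 4) (𝓡 4) ∞ (E.diagStageMap m) (E.U (E.diagLevel (m₀ + 1))) :=
      (E.contMDiffOn_diagStageMap m).mono (E.U_diagLevel_mono (hm.trans (Nat.le_succ m)))
    have hfb : ContDiffOn ℝ ∞ (diagFirstBracket D E (diagIndex D E m) m p) V₀ :=
      ((𝓥.contDiffOn_metricInCoords_comp_chartAt_symm p (E.U _).isOpen hEs).sub
        (𝓥.contDiffOn_metricInCoords_comp_chartAt_symm p (E.U _).isOpen hFs))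
    have hcd : ContDiffOn ℝ ∞ (E.coordDeviation (E.diagLevel (m + 1)) p)
        (c.target ∩ c.symm ⁻¹' (E.U (E.diagLevel (m + 1)) : Set 𝓥.carrier)) := by
      rw [E.coordDeviation_eq_chartDeviation]
      exact contDiffOn_chartDeviation _ (E.U _).isOpen (E.contMDiffOn_embed _) p
    have hfbAt : ∀ y ∈ E.diagRefBall m₀ p,
        ContDiffAt ℝ k (diagFirstBracket D E (diagIndex D E m) m p) y := fun y hy ↦
      ((hfb.of_le (by exact_mod_cast le_top)).contDiffAt (hV₀o.mem_nhds (hBV₀ hy)))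
    have hcdAt : ∀ y ∈ E.diagRefBall m₀ p,
        ContDiffAt ℝ k (E.coordDeviation (E.diagLevel (m + 1)) p) y := fun y hy ↦
      (hcd.of_le (by exact_mod_cast le_top)).contDiffAt
        ((c.continuousOn_symm.isOpen_inter_preimage c.open_target (E.U _).isOpen).mem_nhds
          ⟨hBt hy, E.U_diagLevel_mono (hm.trans (Nat.le_succ m)) (hBU (mem_image_of_mem _ hy))⟩)
    refine (supCkENorm_add_le hfbAt hcdAt).trans (add_le_add ?_ le_rfl)
    exact (diagIndexGood_diagIndex D E m).2.2 m₀ (Finset.mem_range.2 (by omega)) p hp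
  -- both bounds tend to zero
  have hlim1 : Tendsto (fun m : ℕ ↦ ((m + 1 : ℕ) : ℝ≥0∞)⁻¹) atTop (𝓝 0) :=
    ENNReal.tendsto_inv_nat_nhds_zero.comp (tendsto_add_atTop_nat 1)
  have hlim2 : Tendsto (fun m ↦ supCkENorm (E.diagRefBall m₀ p) k
      (E.coordDeviation (E.diagLevel (m + 1)) p)) atTop (𝓝 0) :=
    (E.tendsto_supCkENorm_coordDeviation p (E.isCompact_diagRefBall m₀ p) hBt).comp
      (E.strictMono_diagLevel.tendsto_atTop.comp (tendsto_add_atTop_nat 1))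
  have hsum := hlim1.add hlim2
  rw [add_zero] at hsum
  exact tendsto_of_tendsto_of_tendsto_of_le_of_le' tendsto_const_nhds hsum
    (Eventually.of_forall fun _ ↦ zero_le) hupper

/-- **Convergence of the general diagonal datum** in every preferred chart of the limit, on every
compact chart piece (transfer from the reference balls). [cite: Petersen2006, Ch. 10 §3.2] -/
theorem tendsto_supCkENorm_diag (x : 𝓥.carrier) {K : Set E4} (hK : IsCompact K)
    (hKt : K ⊆ (chartAt E4 x).target) :
    Tendsto (fun m ↦ supCkENorm K k
      (chartDeviation (𝓢ᵢₙ (E.diagStage m) ((D (E.diagStage m)).sub (diagIndex D E m)))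
        (diagEmbed D E m) x)) atTop (𝓝 0) := by
  -- the reference family
  let J := (m : ℕ) × (E.diagRefPoints m : Set 𝓥.carrier)
  refine tendsto_supCkENorm_chartDeviation_of_reference
    (𝓢 := fun m ↦ 𝓢ᵢₙ (E.diagStage m) ((D (E.diagStage m)).sub (diagIndex D E m)))
    (E := fun m ↦ diagEmbed D E m) ?_
    (J := J) (fun j ↦ (j.2 : 𝓥.carrier))
    (fun j ↦ ball (chartAt E4 (j.2 : 𝓥.carrier) j.2) (E.diagRefRadius j.1 j.2))
    (fun j ↦ E.diagRefBall j.1 j.2) (fun _ ↦ isOpen_ball) (fun _ ↦ ball_subset_closedBall)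
    (fun j ↦ E.isCompact_diagRefBall j.1 j.2) (fun j ↦ (E.diagRefBall_spec j.2.2).2.1) ?_ ?_ x
    hK hKt
  · -- smoothness on compacts, eventually
    intro C hC
    have hev : ∀ᶠ m in atTop, C ⊆ E.U (E.diagLevel m) :=
      E.strictMono_diagLevel.tendsto_atTop.eventually (E.eventually_subset_U hC)
    filter_upwards [hev] with m hm
    exact ⟨E.U (E.diagLevel m), (E.U _).isOpen, hm, contMDiffOn_diagEmbed D E m⟩
  · -- the cores cover
    intro q
    have hq : q ∈ ⋃ n, (E.U n : Set 𝓥.carrier) := E.iUnion_U.symm ▸ mem_univ q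
    obtain ⟨n, hn⟩ := mem_iUnion.1 hq
    have hqn : q ∈ closure (E.U (E.diagLevel n) : Set 𝓥.carrier) :=
      subset_closure (E.monotone_U (E.strictMono_diagLevel.id_le n) hn)
    obtain ⟨p, hp, hqp⟩ := mem_iUnion₂.1 (E.closure_U_diagLevel_subset_refCover n hqn)
    exact ⟨⟨n, ⟨p, hp⟩⟩, hqp.1, hqp.2⟩
  · -- convergence on the reference balls
    intro j
    exact tendsto_supCkENorm_diagRefBall D E j.2.2

/-- **The general diagonal datum ("limits of limits are limits", stage-dependent first data).**
From `E : (𝓤ᵢ, uᵢ) ⇀ (𝓥, v)` and data `D i : (𝓢ᵢₙ, pᵢₙ)ₙ ⇀ (𝓤ᵢ, uᵢ)`, the diagonal sequence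
`m ↦ (𝓢_{i(m), sub (index m)}, φ_{i(m), index m}(F_{level (m+1)} v))` subconverges to `(𝓥, v)`:
exhaustion `U ∘ level`, comparison maps the composites `φ_{i(m), index m} ∘ F_{level (m+1)}`
(local diffeomorphisms, injective and orientation-preserving on `U (level m)` by the choice of the
indices), and `Cᵏ` convergence of the pulled-back metrics by `tendsto_supCkENorm_diag`.
Hale 1980, Ch. I §8, Thm. 8.1; Petersen 2006, Ch. 10, §3.2. [cite: Hale1980, Ch. I §8 Thm. 8.1] -/
def diag : LocalSubconvergence
    (fun m ↦ 𝓢ᵢₙ (E.diagStage m) ((D (E.diagStage m)).sub (diagIndex D E m)))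
    (diagBasepoint D E) 𝓥 v₀ k where
  sub := id
  strictMono_sub := strictMono_id
  U := fun m ↦ E.U (E.diagLevel m)
  monotone_U := fun _ _ h ↦ E.U_diagLevel_mono h
  mem_U := E.basepoint_mem_U _
  iUnion_U := by
    refine eq_univ_of_forall fun x ↦ ?_
    have hx : x ∈ ⋃ n, (E.U n : Set 𝓥.carrier) := E.iUnion_U.symm ▸ mem_univ x
    obtain ⟨n, hn⟩ := mem_iUnion.1 hx
    exact mem_iUnion.2 ⟨n, E.monotone_U (E.strictMono_diagLevel.id_le n) hn⟩
  isCompact_closure_U := fun m ↦ E.isCompact_closure_U _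
  embed := diagEmbed D E
  isLocalDiffeomorphOn_embed := isLocalDiffeomorphOn_diagEmbed D E
  injOn_embed := injOn_diagEmbed D E
  embed_basepoint := fun _ ↦ rfl
  isFutureDirected_mfderiv_embed := fun m _ hx ↦ isFutureDirected_mfderiv_diagEmbed D E m hx
  tendsto_supCkENorm := fun x K hK hKt ↦ tendsto_supCkENorm_diag D E x hK hKt

end Datum

end LocalSubconvergence

/-! ### The `Prop`-level statements -/

section PropLevel

variable {𝓤ᵢ : ℕ → Spacetime.{v} 4} {uᵢ : ∀ i, (𝓤ᵢ i).carrier} {𝓥 : Spacetime.{w} 4}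
  {v₀ : 𝓥.carrier} {k : ℕ}

/-- **Limits of limits are limits, for families** (`Prop` level): if `(𝓤ᵢ, uᵢ) ⇀ (𝓥, v)` and each
`(𝓤ᵢ, uᵢ)` is a pointed `Cᵏ_loc` limit of a sequence `(𝓢ᵢₙ, pᵢₙ)ₙ`, then `(𝓥, v)` is a pointed
`Cᵏ_loc` limit of the diagonal sequence `(𝓢_{i(m), sub (index m)}, Q m)` of some data `D`, `E`
(stages `E.diagStage` strictly increasing: `strictMono_diagStage`; base points
`Q m = φ_{i(m), index m}(u_{i(m)})`: `diagBasepoint_eq`). [cite: Hale1980, Ch. I §8 Thm. 8.1] -/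
theorem SubconvergesLocallyTo.diag {𝓢ᵢₙ : ℕ → ℕ → Spacetime.{u} 4}
    {pᵢₙ : ∀ i n, (𝓢ᵢₙ i n).carrier}
    (hD : ∀ i, SubconvergesLocallyTo (𝓢ᵢₙ i) (pᵢₙ i) (𝓤ᵢ i) (uᵢ i) k)
    (hE : SubconvergesLocallyTo 𝓤ᵢ uᵢ 𝓥 v₀ k) :
    ∃ (D : ∀ j, LocalSubconvergence (𝓢ᵢₙ j) (pᵢₙ j) (𝓤ᵢ j) (uᵢ j) k)
      (E : LocalSubconvergence 𝓤ᵢ uᵢ 𝓥 v₀ k),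
      SubconvergesLocallyTo
        (fun m ↦ 𝓢ᵢₙ (E.diagStage m) ((D (E.diagStage m)).sub (LocalSubconvergence.diagIndex D E m)))
        (LocalSubconvergence.diagBasepoint D E) 𝓥 v₀ k :=
  ⟨fun j ↦ Classical.choice (hD j), Classical.choice hE,
    ⟨LocalSubconvergence.diag (fun j ↦ Classical.choice (hD j)) (Classical.choice hE)⟩⟩

/-- **The hull of a spacetime is closed** (limit sets are closed, Hale 1980, Thm. I.8.1): if every
`(𝓤ᵢ, uᵢ)` is a pointed `Cᵏ_loc` limit of translates of ONE spacetime `𝓢` and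
`(𝓤ᵢ, uᵢ) ⇀ (𝓥, v)`, then `(𝓥, v)` is a pointed `Cᵏ_loc` limit of translates of `𝓢`.
[cite: Hale1980, Ch. I §8 Thm. 8.1] -/
theorem SubconvergesLocallyTo.hull_closed {𝓢 : Spacetime.{u} 4} {q : ℕ → ℕ → 𝓢.carrier}
    (hD : ∀ i, SubconvergesLocallyTo (fun _ ↦ 𝓢) (q i) (𝓤ᵢ i) (uᵢ i) k)
    (hE : SubconvergesLocallyTo 𝓤ᵢ uᵢ 𝓥 v₀ k) :
    ∃ Q : ℕ → 𝓢.carrier, SubconvergesLocallyTo (fun _ ↦ 𝓢) Q 𝓥 v₀ k := by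
  obtain ⟨D, E, hQ⟩ := SubconvergesLocallyTo.diag hD hE
  exact ⟨_, hQ⟩

/-- **The hull is closed, at arbitrary base points**: under the hypotheses of `hull_closed`,
`(𝓥, x)` is a limit of translates of `𝓢` for EVERY `x : 𝓥` (closedness followed by re-basing,
`SubconvergesLocallyTo.rebase`). [cite: Hale1980, Ch. I §8 Thm. 8.1] -/
theorem SubconvergesLocallyTo.hull_closed_rebase {𝓢 : Spacetime.{u} 4} {q : ℕ → ℕ → 𝓢.carrier}
    (hD : ∀ i, SubconvergesLocallyTo (fun _ ↦ 𝓢) (q i) (𝓤ᵢ i) (uᵢ i) k)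
    (hE : SubconvergesLocallyTo 𝓤ᵢ uᵢ 𝓥 v₀ k) (x : 𝓥.carrier) :
    ∃ Q : ℕ → 𝓢.carrier, SubconvergesLocallyTo (fun _ ↦ 𝓢) Q 𝓥 x k := by
  obtain ⟨Q, hQ⟩ := SubconvergesLocallyTo.hull_closed hD hE
  exact hQ.rebase x

end PropLevel

end Spacetime

end Literature.Geometry.Lorentzian
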